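import Mathlib.Data.Nat.Choose.Sum
import Literature.Analysis.FluidPDE.SawtoothCascadeProfileHigherDerivatives
import Summits.AnomalousDissipation.AnomalousDissipation.Theorems.SawtoothPulseCascadeK1LocalisedCascadeSymbolFibreTools

/-!
# K1loc, line `Spectral` / SeqCone — helper: THE MULTIPLIER CONSTANTS OF THE STRIP CUT-OFFS (S-B multiplier data)

Helper file of the prover lane on the crux `K1LocalisedCascade` (stmt-AnomalousDissipation-19491), route
`SawtoothPulseCascade` (memo v6 addendum §C "Θ_α, B_α, W_r for the Ũ-gauged multipliers"; glue seat k1loc-p3).  The un-gauging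
brick `…SlotMultiplierData.norm_comp_eval_G_le` bounds the derivative multipliers `Θ_α` of `X(y)·e^{−2πinγŨ(y)}e^{2πiby}` on the
flat strips by ANY bound `B_α` of the flat Leibniz sequence `p_0 = X`, `p_{α+1} = p_α′ + c·p_α` (`c = 2πi(b − ns)` constant);
`…SlotWienerBound` turns `B_{r+2}` into the remainder weight `W_r`.  This file supplies the numbers:
* `norm_iteratedDeriv_flatLeibniz_le` / `norm_flatLeibniz_le` — `‖p_α⁽ᵐ⁾‖ ≤ Σ_{i+j=α} C(α,i)‖c‖ⁱ D_{j+m}` from sup bounds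
  `‖X⁽ᵏ⁾‖ ≤ D_k` (binomial recursion; no factor from the oscillation `n` when `b` is the rounding of `ns`);
* `norm_iteratedDeriv_ofReal_comp` — `‖(↑X)⁽ᵏ⁾‖ = |X⁽ᵏ⁾|` for a real profile;
* `exists_bound_iteratedDeriv_smoothTransition_le` — one bound for `|sT⁽ⁱ⁾|`, `i ≤ k`;
* `abs_iteratedDeriv_cutoff_comp_le` — for the strip cut-off `X = sT((V − c₀)/ε)` of `…StripCutoff` over ANY smooth slope
  function `V` with `|V⁽ⁱ⁾| ≤ Dⁱ` (`1 ≤ i ≤ k`), `0 < ε ≤ 1`: `|X⁽ᵏ⁾| ≤ k!·C·(D/ε)ᵏ` (Faà di Bruno bound, Mathlib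
  `norm_iteratedFDeriv_comp_le`);
* `abs_iteratedDeriv_deriv_U_le_pow` — the cascade slope `V = U_j′` has `|V⁽ⁱ⁾| ≤ (4πN_j/δ_j)ⁱ` for `1 ≤ i ≤ 4` (tree caps
  `|U_j⁽ᵏ⁾| ≤ c_k(2πN_j)^{k−1}/δ_j^{k−1}`, `k ≤ 5`), hence `abs_iteratedDeriv_cutoff_deriv_U_le`:
  `|X^σ_j⁽ᵏ⁾| ≤ k!·C·(4πN_j/(εδ_j))ᵏ` for `k ≤ 4` — the `D_k` (so `B_α`, `α ≤ 4`, and `W_r`, `r ≤ 2`) of the assembly.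
No definitions; no statement about the stub.  [cite: Grafakos2014, Prop. 3.1.2 (5)] [problem: turb]
-/

-- `Summit.<Summit>.<Problem>`: single-conjunct summit, the duplicate namespace segment is deliberate.
set_option linter.dupNamespace false

noncomputable section

namespace Summit.AnomalousDissipation.AnomalousDissipation.Theorems.SawtoothPulseCascade.K1Cutoff

open Set Filter Topology Real Finset
open scoped ContDiff Nat
open Literature.Analysis.FluidPDE.SawtoothCascade Literature.Analysis.FluidPDE.SawtoothCascade.CascadeParams

/-! ## The flat Leibniz sequence: closed-form bound -/

/-- Smoothness of the flat Leibniz sequence `p_0 = X`, `p_{α+1} = p_α′ + c·p_α`. [folklore] -/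
theorem contDiff_flatLeibniz {X : ℝ → ℂ} (hX : ContDiff ℝ ∞ X) {c : ℂ} {p : ℕ → ℝ → ℂ} (hp0 : p 0 = X)
    (hps : ∀ α, p (α + 1) = fun y => deriv (p α) y + c * p α y) (α : ℕ) : ContDiff ℝ ∞ (p α) := by
  induction α with
  | zero => rw [hp0]; exact hX
  | succ α ih =>
    rw [hps α]
    exact (ih.iterate_deriv 1).add (contDiff_const.mul ih)

/-- The derivatives of the flat Leibniz sequence: `p_{α+1}⁽ᵐ⁾ = p_α⁽ᵐ⁺¹⁾ + c·p_α⁽ᵐ⁾`. [folklore] -/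
theorem iteratedDeriv_flatLeibniz_succ {X : ℝ → ℂ} (hX : ContDiff ℝ ∞ X) {c : ℂ} {p : ℕ → ℝ → ℂ} (hp0 : p 0 = X)
    (hps : ∀ α, p (α + 1) = fun y => deriv (p α) y + c * p α y) (α m : ℕ) (y : ℝ) :
    iteratedDeriv m (p (α + 1)) y = iteratedDeriv (m + 1) (p α) y + c * iteratedDeriv m (p α) y := by
  have hsm := contDiff_flatLeibniz hX hp0 hps α
  have h1 : ContDiffAt ℝ m (fun y => deriv (p α) y) y := ((hsm.iterate_deriv 1).of_le (by exact_mod_cast le_top)).contDiffAt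
  have h2 : ContDiffAt ℝ m (fun y => c * p α y) y := ((contDiff_const.mul hsm).of_le (by exact_mod_cast le_top)).contDiffAt
  rw [hps α, iteratedDeriv_fun_add h1 h2, iteratedDeriv_succ', iteratedDeriv_const_mul_field]

/-- **Sup bounds of the flat Leibniz sequence and all its derivatives**: if `‖X⁽ᵏ⁾‖ ≤ D_k` for all `k`, then
`‖p_α⁽ᵐ⁾(y)‖ ≤ Σ_{i ≤ α} C(α,i)‖c‖ⁱ D_{α−i+m}`. [cite: Grafakos2014, Prop. 3.1.2 (5)] -/
theorem norm_iteratedDeriv_flatLeibniz_le {X : ℝ → ℂ} (hX : ContDiff ℝ ∞ X) {c : ℂ} {p : ℕ → ℝ → ℂ} (hp0 : p 0 = X)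
    (hps : ∀ α, p (α + 1) = fun y => deriv (p α) y + c * p α y) {D : ℕ → ℝ} (hD : ∀ k y, ‖iteratedDeriv k X y‖ ≤ D k)
    (α m : ℕ) (y : ℝ) :
    ‖iteratedDeriv m (p α) y‖ ≤ ∑ i ∈ range (α + 1), (α.choose i : ℝ) * ‖c‖ ^ i * D (α - i + m) := by
  induction α generalizing m with
  | zero => simpa [hp0] using hD m y
  | succ α ih =>
    rw [iteratedDeriv_flatLeibniz_succ hX hp0 hps α m y]
    -- Pascal: split the target sum
    have hsplit := sum_choose_succ_mul (R := ℝ) (fun i j => ‖c‖ ^ i * D (j + m)) α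
    have e1 : ∀ i ∈ range (α + 1 + 1), ((α + 1).choose i : ℝ) * ‖c‖ ^ i * D (α + 1 - i + m) =
        ((α + 1).choose i : ℝ) * (‖c‖ ^ i * D (α + 1 - i + m)) := fun i _ => by ring
    rw [sum_congr rfl e1, hsplit]
    refine (norm_add_le _ _).trans (add_le_add ?_ ?_)
    · refine (ih (m + 1)).trans (le_of_eq (sum_congr rfl fun i hi => ?_))
      have hi' : i ≤ α := Nat.lt_succ_iff.mp (mem_range.mp hi)
      rw [show α - i + (m + 1) = α + 1 - i + m by omega]; ring
    · rw [norm_mul]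
      calc ‖c‖ * ‖iteratedDeriv m (p α) y‖ ≤ ‖c‖ * ∑ i ∈ range (α + 1), (α.choose i : ℝ) * ‖c‖ ^ i * D (α - i + m) :=
            mul_le_mul_of_nonneg_left (ih m) (norm_nonneg _)
        _ = ∑ i ∈ range (α + 1), (α.choose i : ℝ) * (‖c‖ ^ (i + 1) * D (α - i + m)) := by
            rw [mul_sum]; refine sum_congr rfl fun i _ => ?_; ring

/-- **Sup bounds of the flat Leibniz sequence** (`m = 0`): `‖p_α(y)‖ ≤ Σ_{i ≤ α} C(α,i)‖c‖ⁱ D_{α−i}` — the hypothesis `hB` of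
`…SlotMultiplierData.norm_comp_eval_G_le` with `B_α` this sum. [cite: Grafakos2014, Prop. 3.1.2 (5)] -/
theorem norm_flatLeibniz_le {X : ℝ → ℂ} (hX : ContDiff ℝ ∞ X) {c : ℂ} {p : ℕ → ℝ → ℂ} (hp0 : p 0 = X)
    (hps : ∀ α, p (α + 1) = fun y => deriv (p α) y + c * p α y) {D : ℕ → ℝ} (hD : ∀ k y, ‖iteratedDeriv k X y‖ ≤ D k)
    (α : ℕ) (y : ℝ) : ‖p α y‖ ≤ ∑ i ∈ range (α + 1), (α.choose i : ℝ) * ‖c‖ ^ i * D (α - i) := by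
  simpa using norm_iteratedDeriv_flatLeibniz_le hX hp0 hps hD α 0 y

/-- **Real profiles seen in `ℂ`**: `‖(y ↦ (X y : ℂ))⁽ᵏ⁾(y)‖ = |X⁽ᵏ⁾(y)|` for smooth `X : ℝ → ℝ`. [folklore] -/
theorem norm_iteratedDeriv_ofReal_comp {X : ℝ → ℝ} (hX : ContDiff ℝ ∞ X) (k : ℕ) (y : ℝ) :
    ‖iteratedDeriv k (fun y => (X y : ℂ)) y‖ = |iteratedDeriv k X y| := by
  rw [← Real.norm_eq_abs, ← norm_iteratedFDeriv_eq_norm_iteratedDeriv (f := fun y => (X y : ℂ)),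
    ← norm_iteratedFDeriv_eq_norm_iteratedDeriv (f := X), show (fun y => (X y : ℂ)) = Complex.ofRealLI ∘ X from rfl,
    Complex.ofRealLI.norm_iteratedFDeriv_comp_left (hX.contDiffAt (n := ∞)) (by exact_mod_cast le_top)]

/-! ## Derivatives of the strip cut-off `X = sT((V − c₀)/ε)` -/

/-- One bound for the first `k + 1` derivatives of the smooth transition: `∃ C ≥ 0, ∀ i ≤ k, |sT⁽ⁱ⁾| ≤ C`. [folklore] -/
theorem exists_bound_iteratedDeriv_smoothTransition_le (k : ℕ) :
    ∃ C : ℝ, 0 ≤ C ∧ ∀ i ≤ k, ∀ x, |iteratedDeriv i smoothTransition x| ≤ C := by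
  induction k with
  | zero =>
    obtain ⟨C, hC0, hC⟩ := exists_bound_iteratedDeriv_smoothTransition 0
    exact ⟨C, hC0, fun i hi x => by rw [Nat.le_zero.mp hi]; exact hC x⟩
  | succ k ih =>
    obtain ⟨C, hC0, hC⟩ := ih
    obtain ⟨C', hC0', hC'⟩ := exists_bound_iteratedDeriv_smoothTransition (k + 1)
    refine ⟨max C C', le_max_of_le_left hC0, fun i hi x => ?_⟩
    rcases Nat.lt_succ_iff_lt_or_eq.mp (Nat.lt_succ_iff.mpr hi) with h | h
    · exact (hC i (Nat.lt_succ_iff.mp h) x).trans (le_max_left _ _)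
    · rw [h]; exact (hC' x).trans (le_max_right _ _)

/-- **Faà di Bruno bound for the strip cut-off.**  Let `V : ℝ → ℝ` be smooth with `|V⁽ⁱ⁾(y)| ≤ Dⁱ` for `1 ≤ i ≤ k` (at the
point `y`; any real `D`), `0 < ε ≤ 1`, and `|sT⁽ⁱ⁾| ≤ C` for `i ≤ k`.  Then the cut-off `X(y) = sT((V(y) − c₀)/ε)` satisfies
`|X⁽ᵏ⁾(y)| ≤ k!·C·(D/ε)ᵏ`. [cite: Grafakos2014, Prop. 3.1.2 (5)] -/
theorem abs_iteratedDeriv_cutoff_comp_le {V : ℝ → ℝ} (hV : ContDiff ℝ ∞ V) {k : ℕ} {C : ℝ}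
    (hC : ∀ i ≤ k, ∀ x, |iteratedDeriv i smoothTransition x| ≤ C) {ε : ℝ} (hε : 0 < ε) (hε1 : ε ≤ 1) (c₀ : ℝ) {D : ℝ}
    {y : ℝ} (hD : ∀ i, 1 ≤ i → i ≤ k → |iteratedDeriv i V y| ≤ D ^ i) :
    |iteratedDeriv k (fun y => smoothTransition ((V y - c₀) / ε)) y| ≤ k ! * C * (D / ε) ^ k := by
  have hC0 : 0 ≤ C := (abs_nonneg _).trans (hC 0 (Nat.zero_le _) 0)
  -- outer function `g(v) = sT(−c₀/ε + ε⁻¹ v)`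
  set g : ℝ → ℝ := fun v => smoothTransition (-c₀ / ε + ε⁻¹ * v) with hg
  have hfun : (fun y => smoothTransition ((V y - c₀) / ε)) = g ∘ V := by
    funext y; simp only [hg, Function.comp_apply]; congr 1; field_simp; ring
  have hgs : ContDiff ℝ ∞ g := contDiff_smoothTransition_linear _ _
  -- derivatives of `g`: `|g⁽ⁱ⁾| ≤ C/εⁱ ≤ C/εᵏ`
  have hε' : 1 ≤ ε⁻¹ := one_le_inv_iff₀.mpr ⟨hε, hε1⟩
  have hgC : ∀ i, i ≤ k → ‖iteratedFDeriv ℝ i g (V y)‖ ≤ C / ε ^ k := by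
    intro i hi
    rw [norm_iteratedFDeriv_eq_norm_iteratedDeriv, Real.norm_eq_abs, hg, iteratedDeriv_smoothTransition_linear, abs_mul,
      abs_pow, abs_of_pos (inv_pos.mpr hε)]
    calc ε⁻¹ ^ i * |iteratedDeriv i smoothTransition (-c₀ / ε + ε⁻¹ * V y)| ≤ ε⁻¹ ^ k * C :=
          mul_le_mul (pow_le_pow_right₀ hε' hi) (hC i hi _) (abs_nonneg _) (by positivity)
      _ = C / ε ^ k := by rw [inv_pow]; ring
  have hVD : ∀ i, 1 ≤ i → i ≤ k → ‖iteratedFDeriv ℝ i V y‖ ≤ D ^ i := fun i h1 hi => by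
    rw [norm_iteratedFDeriv_eq_norm_iteratedDeriv, Real.norm_eq_abs]; exact hD i h1 hi
  have h := norm_iteratedFDeriv_comp_le hgs hV (n := k) (by exact_mod_cast le_top) y hgC hVD
  rw [hfun, ← Real.norm_eq_abs, ← norm_iteratedFDeriv_eq_norm_iteratedDeriv]
  calc ‖iteratedFDeriv ℝ k (g ∘ V) y‖ ≤ k ! * (C / ε ^ k) * D ^ k := h
    _ = k ! * C * (D / ε) ^ k := by rw [div_pow]; ring

/-- The cut-off is bounded by one: `|X(y)| ≤ 1` (order `0`). [folklore] -/
theorem abs_cutoff_comp_le_one (V : ℝ → ℝ) (c₀ ε y : ℝ) : |smoothTransition ((V y - c₀) / ε)| ≤ 1 := by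
  rw [abs_of_nonneg (Real.smoothTransition.nonneg _)]; exact Real.smoothTransition.le_one _

/-! ## The cascade slope `V = U_j′`: `|V⁽ⁱ⁾| ≤ (4πN_j/δ_j)ⁱ` for `1 ≤ i ≤ 4` -/

variable (P : CascadeParams)

/-- **Power caps for the cascade slope**: with `V = U_j′` and `Λ = 4πN_j/δ_j`, `|V⁽ⁱ⁾(y)| ≤ Λⁱ` for `1 ≤ i ≤ 4`
(`δ_j > 0`; from the tree caps `|U_j″| ≤ 2√(2π)N_j/δ_j`, `|U_j‴| ≤ 2(2πN_j)²/δ_j²`, `|U_j⁗| ≤ 10(2πN_j)³/(δ_j³√(2π))`,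
`|U_j⁽⁵⁾| ≤ 12(2πN_j)⁴/δ_j⁴`). [cite: ElgindiLissMattingly2025, §1 and Rmk. 1.4 (the smoothed pulse profiles)] -/
theorem abs_iteratedDeriv_deriv_U_le_pow {j : ℕ} (hδ : 0 < P.δ j) {i : ℕ} (h1 : 1 ≤ i) (h4 : i ≤ 4) (y : ℝ) :
    |iteratedDeriv i (deriv (P.U j)) y| ≤ (4 * Real.pi * P.N j / P.δ j) ^ i := by
  have hπ : 0 < Real.pi := Real.pi_pos
  have hN : (0 : ℝ) ≤ P.N j := Nat.cast_nonneg _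
  have hsq : Real.sqrt (2 * Real.pi) ≤ 2 * Real.pi := by
    rw [Real.sqrt_le_left (by positivity)]; nlinarith [Real.pi_gt_three]
  set Λ : ℝ := 4 * Real.pi * P.N j / P.δ j with hΛ
  interval_cases i
  · -- `V′ = U″`
    rw [iteratedDeriv_one, pow_one]
    refine (P.abs_deriv_deriv_U_le hδ y).trans ?_
    rw [hΛ, div_le_div_iff_of_pos_right hδ]
    nlinarith
  · -- `V″ = U‴`
    have e : iteratedDeriv 2 (deriv (P.U j)) = deriv (deriv (deriv (P.U j))) := by
      simp only [iteratedDeriv_succ, iteratedDeriv_zero]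
    rw [e]
    refine (P.abs_deriv3_U_le hδ y).trans ?_
    rw [hΛ, div_pow, div_le_div_iff₀ (by positivity) (by positivity)]
    nlinarith [sq_nonneg (Real.pi * P.N j), hδ]
  · have e : iteratedDeriv 3 (deriv (P.U j)) = deriv (deriv (deriv (deriv (P.U j)))) := by
      simp only [iteratedDeriv_succ, iteratedDeriv_zero]
    rw [e]
    refine (P.abs_deriv4_U_le hδ y).trans ?_
    rw [hΛ, div_pow, div_le_div_iff₀ (by positivity) (by positivity)]
    -- `10 (2πN)³ δ³ ≤ (4πN)³ δ³ √(2π)`: `80 ≤ 64 √(2π)` since `√(2π) ≥ 2`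
    have hsq2 : 2 ≤ Real.sqrt (2 * Real.pi) := by
      rw [Real.le_sqrt' two_pos]; nlinarith [Real.pi_gt_three]
    have hA : 0 ≤ (Real.pi * P.N j) ^ 3 * P.δ j ^ 3 := by positivity
    nlinarith [mul_le_mul_of_nonneg_left hsq2 hA]
  · have e : iteratedDeriv 4 (deriv (P.U j)) = deriv (deriv (deriv (deriv (deriv (P.U j))))) := by
      simp only [iteratedDeriv_succ, iteratedDeriv_zero]
    rw [e]
    refine (P.abs_deriv5_U_le hδ y).trans ?_
    rw [hΛ, div_pow, div_le_div_iff₀ (by positivity) (by positivity)]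
    nlinarith [pow_nonneg (mul_nonneg hπ.le hN) 4, pow_pos hδ 4, mul_nonneg (pow_nonneg (mul_nonneg hπ.le hN) 4) (pow_pos hδ 4).le]

/-- **The multiplier constants of the cascade's strip cut-offs.**  For the slope `V = U_j′` (`δ_j > 0`), a width
`0 < ε ≤ 1`, any level `c₀`, an order `k ≤ 4` and a bound `C` of `|sT⁽ⁱ⁾|`, `i ≤ k`:
`|(sT((U_j′ − c₀)/ε))⁽ᵏ⁾(y)| ≤ k!·C·(4πN_j/(δ_jε))ᵏ` — the `D_k` of `norm_flatLeibniz_le` for `X⁺ = sT((U_j′ − (1−2ε))/ε)`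
(the `−` family: apply with `V ↦ −V` via `abs_iteratedDeriv_cutoff_neg_deriv_U_le`).
[cite: ElgindiLissMattingly2025, §1 and Rmk. 1.4 (the smoothed pulse profiles)] -/
theorem abs_iteratedDeriv_cutoff_deriv_U_le {j : ℕ} (hδ : 0 < P.δ j) {k : ℕ} (hk : k ≤ 4) {C : ℝ}
    (hC : ∀ i ≤ k, ∀ x, |iteratedDeriv i smoothTransition x| ≤ C) {ε : ℝ} (hε : 0 < ε) (hε1 : ε ≤ 1) (c₀ y : ℝ) :
    |iteratedDeriv k (fun y => smoothTransition ((deriv (P.U j) y - c₀) / ε)) y| ≤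
      k ! * C * (4 * Real.pi * P.N j / (P.δ j * ε)) ^ k := by
  have h := abs_iteratedDeriv_cutoff_comp_le (P.contDiff_deriv_U hδ) hC hε hε1 c₀ (D := 4 * Real.pi * P.N j / P.δ j)
    (y := y) (fun i h1 hi => abs_iteratedDeriv_deriv_U_le_pow P hδ h1 (hi.trans hk) y)
  rwa [div_div] at h

/-- The same for the `−` family `X⁻ = sT((−U_j′ − c₀)/ε)`. [cite: ElgindiLissMattingly2025, §1 and Rmk. 1.4 (the smoothed pulse profiles)] -/
theorem abs_iteratedDeriv_cutoff_neg_deriv_U_le {j : ℕ} (hδ : 0 < P.δ j) {k : ℕ} (hk : k ≤ 4) {C : ℝ}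
    (hC : ∀ i ≤ k, ∀ x, |iteratedDeriv i smoothTransition x| ≤ C) {ε : ℝ} (hε : 0 < ε) (hε1 : ε ≤ 1) (c₀ y : ℝ) :
    |iteratedDeriv k (fun y => smoothTransition ((-deriv (P.U j) y - c₀) / ε)) y| ≤
      k ! * C * (4 * Real.pi * P.N j / (P.δ j * ε)) ^ k := by
  have hVn : ContDiff ℝ ∞ (fun y => -deriv (P.U j) y) := (P.contDiff_deriv_U hδ).neg
  have hDn : ∀ i, 1 ≤ i → i ≤ k → |iteratedDeriv i (fun y => -deriv (P.U j) y) y| ≤ (4 * Real.pi * P.N j / P.δ j) ^ i := by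
    intro i h1 hi
    rw [iteratedDeriv_fun_neg, abs_neg]
    exact abs_iteratedDeriv_deriv_U_le_pow P hδ h1 (hi.trans hk) y
  have h := abs_iteratedDeriv_cutoff_comp_le hVn hC hε hε1 c₀ (D := 4 * Real.pi * P.N j / P.δ j) (y := y) hDn
  rwa [div_div] at h


/-! ## Appended: the flat Leibniz bound from finitely many derivative bounds -/

/-- **Sup bounds of the flat Leibniz sequence from finitely many derivative bounds**: if `‖X⁽ᵏ⁾‖ ≤ D_k` for `k ≤ K` only,
then `‖p_α⁽ᵐ⁾(y)‖ ≤ Σ_{i ≤ α} C(α,i)‖c‖ⁱ D_{α−i+m}` whenever `α + m ≤ K` (the orders actually used).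
[cite: Grafakos2014, Prop. 3.1.2 (5)] -/
theorem norm_iteratedDeriv_flatLeibniz_le_of_le {X : ℝ → ℂ} (hX : ContDiff ℝ ∞ X) {c : ℂ} {p : ℕ → ℝ → ℂ}
    (hp0 : p 0 = X) (hps : ∀ α, p (α + 1) = fun y => deriv (p α) y + c * p α y) {K : ℕ} {D : ℕ → ℝ}
    (hD : ∀ k ≤ K, ∀ y, ‖iteratedDeriv k X y‖ ≤ D k) {α m : ℕ} (hαm : α + m ≤ K) (y : ℝ) :
    ‖iteratedDeriv m (p α) y‖ ≤ ∑ i ∈ range (α + 1), (α.choose i : ℝ) * ‖c‖ ^ i * D (α - i + m) := by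
  induction α generalizing m with
  | zero => simpa [hp0] using hD m (by simpa using hαm) y
  | succ α ih =>
    rw [iteratedDeriv_flatLeibniz_succ hX hp0 hps α m y]
    have hsplit := sum_choose_succ_mul (R := ℝ) (fun i j => ‖c‖ ^ i * D (j + m)) α
    have e1 : ∀ i ∈ range (α + 1 + 1), ((α + 1).choose i : ℝ) * ‖c‖ ^ i * D (α + 1 - i + m) =
        ((α + 1).choose i : ℝ) * (‖c‖ ^ i * D (α + 1 - i + m)) := fun i _ => by ring
    rw [sum_congr rfl e1, hsplit]
    refine (norm_add_le _ _).trans (add_le_add ?_ ?_)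
    · refine (ih (m := m + 1) (by omega)).trans (le_of_eq (sum_congr rfl fun i hi => ?_))
      have hi' : i ≤ α := Nat.lt_succ_iff.mp (mem_range.mp hi)
      rw [show α - i + (m + 1) = α + 1 - i + m by omega]; ring
    · rw [norm_mul]
      calc ‖c‖ * ‖iteratedDeriv m (p α) y‖ ≤ ‖c‖ * ∑ i ∈ range (α + 1), (α.choose i : ℝ) * ‖c‖ ^ i * D (α - i + m) :=
            mul_le_mul_of_nonneg_left (ih (m := m) (by omega)) (norm_nonneg _)
        _ = ∑ i ∈ range (α + 1), (α.choose i : ℝ) * (‖c‖ ^ (i + 1) * D (α - i + m)) := by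
            rw [mul_sum]; refine sum_congr rfl fun i _ => ?_; ring

/-- The `m = 0` case: `‖p_α(y)‖ ≤ Σ_{i ≤ α} C(α,i)‖c‖ⁱ D_{α−i}` from `‖X⁽ᵏ⁾‖ ≤ D_k`, `k ≤ α` — the hypothesis `hB` of
`…SlotMultiplierData.norm_comp_eval_G_le` from the `ε`-free bounds of `…FlatCurvatureCascade` (`α ≤ 2`).
[cite: Grafakos2014, Prop. 3.1.2 (5)] -/
theorem norm_flatLeibniz_le_of_le {X : ℝ → ℂ} (hX : ContDiff ℝ ∞ X) {c : ℂ} {p : ℕ → ℝ → ℂ} (hp0 : p 0 = X)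
    (hps : ∀ α, p (α + 1) = fun y => deriv (p α) y + c * p α y) {K : ℕ} {D : ℕ → ℝ}
    (hD : ∀ k ≤ K, ∀ y, ‖iteratedDeriv k X y‖ ≤ D k) {α : ℕ} (hα : α ≤ K) (y : ℝ) :
    ‖p α y‖ ≤ ∑ i ∈ range (α + 1), (α.choose i : ℝ) * ‖c‖ ^ i * D (α - i) := by
  simpa using norm_iteratedDeriv_flatLeibniz_le_of_le hX hp0 hps hD (α := α) (m := 0) (by simpa using hα) y


/-! ## Appended: every derivative of a smooth periodic profile is bounded (the `∀ k` hypothesis of the multiplier bundle) -/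

/-- The iterated derivatives of a `1`-periodic real function are `1`-periodic. [folklore] -/
theorem periodic_iteratedDeriv_real {X : ℝ → ℝ} (hX : Function.Periodic X 1) (k : ℕ) :
    Function.Periodic (iteratedDeriv k X) 1 := by
  induction k with
  | zero => rwa [iteratedDeriv_zero]
  | succ k ih =>
    intro y
    rw [iteratedDeriv_succ]
    have h : iteratedDeriv k X = fun z => iteratedDeriv k X (z + 1) := funext fun z => (ih z).symm
    conv_rhs => rw [h]
    rw [deriv_comp_add_const]

/-- **Every derivative of a smooth `1`-periodic profile is bounded**: `∃ D ≥ 0, |X⁽ᵏ⁾| ≤ D`. [folklore] -/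
theorem exists_bound_iteratedDeriv_of_periodic {X : ℝ → ℝ} (hXp : Function.Periodic X 1) (hXc : ContDiff ℝ ∞ X) (k : ℕ) :
    ∃ D : ℝ, 0 ≤ D ∧ ∀ y, |iteratedDeriv k X y| ≤ D := by
  have hc : Continuous (iteratedDeriv k X) := hXc.continuous_iteratedDeriv k (by exact_mod_cast le_top)
  have hp := periodic_iteratedDeriv_real hXp k
  obtain ⟨C, hC⟩ := isCompact_Icc.exists_bound_of_continuousOn (hc.continuousOn (s := Icc (0 : ℝ) 1))
  refine ⟨max C 0, le_max_right _ _, fun y => ?_⟩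
  have hy : iteratedDeriv k X y = iteratedDeriv k X (Int.fract y) := by
    have h := (hp.int_mul (Int.floor y)) (Int.fract y)
    simp only [mul_one, Int.fract_add_floor] at h
    exact h
  rw [hy]
  exact ((Real.norm_eq_abs _).symm.le.trans (hC _ ⟨Int.fract_nonneg y, (Int.fract_lt_one y).le⟩)).trans (le_max_left _ _)

/-- **A full bound sequence with prescribed low orders**: given bounds `D₀ k` of `|X⁽ᵏ⁾|` for `k ≤ K`, there is `D : ℕ → ℝ`
agreeing with `D₀` up to `K` and bounding ALL derivatives — so the explicit (`ε`-free) constants of orders `≤ K` can be fed to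
a consumer asking for `∀ k`. [folklore] -/
theorem exists_bound_seq_iteratedDeriv_of_periodic {X : ℝ → ℝ} (hXp : Function.Periodic X 1) (hXc : ContDiff ℝ ∞ X)
    {K : ℕ} {D₀ : ℕ → ℝ} (hD₀ : ∀ k ≤ K, ∀ y, |iteratedDeriv k X y| ≤ D₀ k) :
    ∃ D : ℕ → ℝ, (∀ k ≤ K, D k = D₀ k) ∧ ∀ k y, |iteratedDeriv k X y| ≤ D k := by
  choose D₁ hD₁0 hD₁ using exists_bound_iteratedDeriv_of_periodic hXp hXc
  refine ⟨fun k => if k ≤ K then D₀ k else D₁ k, fun k hk => if_pos hk, fun k y => ?_⟩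
  simp only
  split_ifs with hk
  · exact hD₀ k hk y
  · exact hD₁ k y

end Summit.AnomalousDissipation.AnomalousDissipation.Theorems.SawtoothPulseCascade.K1Cutoff
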